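import Summits.BirchSwinnertonDyer.Rank1Residual.P2.CongruentNumberPairsAtTwoEvenFiveFamily
import Summits.BirchSwinnertonDyer.Rank1Residual.P2.CongruentNumberPairsAtTwoEvenThreePrimesDoor
import HarnessLib

/-!
# Sub-lane «bsd-p2»: the `k = 2` EVEN CELL TABLE AS THEOREMS — `s(2t₀t₁)` (Monsky's even `4 × 4` matrix)
# and the parity of `Σ₂′(2t₀t₁)` on the `s = 1` locus (p2-typer GEN 21; file 1 of 2 of the (ε′)
# ORDER 1′ pair — proposed only on p2-lead's SWEEP 2026-08-24 (ε′) ORDER 1′ word)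

HONEST FRAMING (sub-lane «bsd-p2», run/shared/lean/b2b/bsd-rank1-residual/p2/, verbatim in every
file): the target of record is the FULL Birch–Swinnerton-Dyer formula for EVERY analytic-rank `≤ 1`
`E/ℚ` at ALL primes INCLUDING `2`; the odd-prime class ledger is referee A's; the `2`-part is OPEN
(cells O1 = X5 ∖ CM and O12 = the CM corner) and under census by «bsd-p2». Census / instrument
output at `2` = EVIDENCE / conjecture items with held-out validation, NEVER a Literature fact;
certificates close PAIRS (one isogeny class, `p = 2`), never classes. This file asserts NO
arithmetic fact: it is SELECTION-SIDE arithmetic of the integer `n = 2t₀t₁` (residues, Legendre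
bits, Monsky's matrix, Rédei matrices) — no curve quantity is computed or displayed. WHAT IT DOES.
For `n = 2t₀t₁ ≡ 6 (mod 8)` (`t₀ ≠ t₁` odd primes, so `{t₀, t₁ mod 4} = {1, 3}`; write `p` for the
prime `≡ 1 (mod 4)`, `q` for the one `≡ 3 (mod 4)`):
* §1–§2 `s(n)`: Monsky's even matrix `( Aᵀ + D₂  D₋₁ ; D₂  A + D₂ )` has `A = (a a; a a)` with
  `a = [(p/q) = −1]` (reciprocity, `p ≡ 1 (mod 4)`), so `s(n) = 4 − rank M` is a function of
  `(p mod 8, q mod 8, a)`; typed through the landed table route `P2.monskySelmerRankEven_eq_of_table`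
  with counted kernels (`decide`): the row `p ≡ 5 (mod 8)` has **`s = 1` for both signs of `(p/q)`**
  (tuple `(p, q)`; Monsky 1990 Cor 5.15 (2′) prints `#Sel₂ = 8` there — here it is linear algebra),
  and the four cells `p ≡ 1 (mod 8)`, `(p/q) = +1` have **`s = 3`** (both tuple orders); the Legendre
  graph of a class-`6` pair (`p ≡ 1 (8)`, `(p/q) = −1`) is odd; every `n` splits as such a `(p, q)`;
* §3 `Σ₂′(n)` (TYZ's printed second genus sum over `GenusField`), modulo Rédei–Reichardt `hR` ONLY:
  **EVEN on `𝒮⁻`** (`p ≡ 5 (8)`, `(p/q) = −1`; NEW — the other half of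
  `P2/CongruentNumberPairsAtTwoEvenFiveFamily.lean` §2, same Rédei route via `g(p₅q₃)` odd), ODD on a
  class-`6` pair (landed `Tian2014.odd_genusSum₂'_two_mul_caseSix` at tuple length `2`); ODD on `𝒮⁺` is
  the landed `P2.odd_genusSum₂'_genusField_two_mul_five_mul`. Hence at `k = 2` the SILENT `s = 1`
  cells (`Σ₂′` even) are EXACTLY `𝒮⁻` = the family of C-P2-1 — consumed by file 2
  (`P2/CongruentNumberPairsAtTwoEvenRungTwo.lean`: the `k = 2` rung of the even law IS C-P2-1).
Desk cross-check (p2-typer GEN 20 `k2_scope.py`, `n < 30 000`, 1 440 `n`, EVIDENCE): `s = 1` exactly on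
these configurations; `𝒮⁻` 446/446 silent, all other `s = 1` cells loud. 0 facts, 0 defs; nothing
booked; no mark moved. Unit `b2b-bsdres-p2-typer` GEN 21 (terms) / GEN 26 (docstring refresh T-176, decl terms
byte-identical); bytes pre-read by p2-ref GEN 48 — R3 PRE-READ PASS `p2/REFEREE.md` l.447 (2026-08-23); proposed on
p2-lead's SWEEP 2026-08-24 (ε′) ORDER 1′ word (LEAD-OKS § GEN 10 BATCH 86, T-176), FILE 1 before FILE 2, ≤ 1 in flight.

References: [HeathBrown1994SelmerCongruentII] Appendix (Monsky) p. 41 L20–L36; [Monsky1990MockHeegner]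
Cor. 5.15 (2′); [TianYuanZhang2017] Thm 1.2, §1; [Tian2014] Thm 1.3, Lemma 5.3; [LiMa2008] Lemma 0.1,
Thm 0.4; [IrelandRosen1990] Ch. 5 §2; HOME/p2/typer/lean/conjectures/GEN20-EVEN-CP22-DRAFT-V2.md §E, §G.
-/

noncomputable section

open scoped Classical

open Matrix Finset WeierstrassCurve NumberField Literature.NumberTheory.EllipticCurves
  Literature.NumberTheory.EllipticCurves.Rank1Residual
  Literature.NumberTheory.EllipticCurves.Rank1Residual.Typed
  Literature.NumberTheory.EllipticCurves.Monsky1990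
  Literature.NumberTheory.EllipticCurves.HeathBrown1994
  Literature.NumberTheory.EllipticCurves.HeathBrown1994.Families
  Literature.NumberTheory.EllipticCurves.TianYuanZhang2017
  Literature.NumberTheory.EllipticCurves.Tian2014
  Literature.NumberTheory.QuadraticFields.RedeiReichardt

set_option autoImplicit false

namespace Summit.BirchSwinnertonDyer.Rank1Residual.P2

/-! ## §1 The symbols of a pair of odd primes (Monsky's table entries at `k = 2`) -/

section Symbols

/-- The diagonal table entry: `(p/p) = 0 ≠ 1`, so Monsky's additive symbol of `p` at `p` is `1` (the
diagonal of `A` never uses it — `A_ii = Σ_{j ≠ i} A_ij` — but the table route asks for a value).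
[cite: HeathBrown1994SelmerCongruentII, Appendix (Monsky), typescript p. 39 L10–L13] -/
theorem addLegendreSym_self {p : ℕ} (hp : p.Prime) : addLegendreSym p p = 1 := by
  have h : jacobiSym (p : ℤ) p = 0 := by
    rw [jacobiSym.mod_left, Int.emod_self]; exact jacobiSym.zero_left hp.one_lt
  rw [addLegendreSym_def, if_neg (by rw [h]; decide)]

/-- For distinct primes `p ≡ 1 (mod 4)` and `q` odd with `(p/q) = +1`: both table bits `[(q/p) ≠ 1]`,
`[(p/q) ≠ 1]` vanish (quadratic reciprocity). [cite: IrelandRosen1990, Ch. 5 §2 Thm. 1] -/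
theorem addLegendreSym_pair_of_jacobiSym_eq_one {p q : ℕ} (hp4 : p % 4 = 1) (hq : Odd q)
    (hj : jacobiSym p q = 1) : addLegendreSym q p = 0 ∧ addLegendreSym p q = 0 :=
  ⟨addLegendreSym_of_eq_one (by rw [← jacobiSym.quadratic_reciprocity_one_mod_four hp4 hq]; exact hj),
    addLegendreSym_of_eq_one hj⟩

/-- For distinct primes `p ≡ 1 (mod 4)` and `q` odd with `(p/q) = −1`: both table bits are `1`.
[cite: IrelandRosen1990, Ch. 5 §2 Thm. 1] -/
theorem addLegendreSym_pair_of_jacobiSym_eq_neg_one {p q : ℕ} (hp4 : p % 4 = 1) (hq : Odd q)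
    (hj : jacobiSym p q = -1) : addLegendreSym q p = 1 ∧ addLegendreSym p q = 1 :=
  ⟨addLegendreSym_of_eq_neg_one
      (by rw [← jacobiSym.quadratic_reciprocity_one_mod_four hp4 hq]; exact hj),
    addLegendreSym_of_eq_neg_one hj⟩

/-- `(p/q) = ±1` for distinct primes. [cite: IrelandRosen1990, Ch. 5 §2 Prop. 5.2.2] -/
theorem jacobiSym_eq_one_or_eq_neg_one_of_prime_ne {p q : ℕ} (hp : p.Prime) (hq : q.Prime)
    (hne : p ≠ q) : jacobiSym p q = 1 ∨ jacobiSym p q = -1 :=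
  jacobiSym.eq_one_or_neg_one (by
    rw [Int.gcd_natCast_natCast]; exact (Nat.coprime_primes hp hq).mpr hne)

end Symbols

/-! ## §2 Monsky's even matrix at `k = 2`: `s(2t₀t₁)` from five bits; the `p ≡ 5 (8)` row; the `s = 3` cells -/

section Table

/-- **TABLE ROUTE AT `k = 2`.** With `a` the common value of the two reciprocity bits, `d = [(2/tᵢ) ≠ 1]`,
`e = [(−1/tᵢ) ≠ 1]`, a counted kernel `2^s` of the `4 × 4` table matrix
`( Aᵀ + D₂  D₋₁ ; D₂  A + D₂ )`, `A = (a a; a a)`, gives `s(2t₀t₁) = s` (landed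
`P2.monskySelmerRankEven_eq_of_table` on the pair).
[cite: HeathBrown1994SelmerCongruentII, Appendix (Monsky), typescript p. 41 L20–L36] -/
theorem monskySelmerRankEven_pair_eq_of_bits (t : Fin 2 → ℕ) (ht : ∀ i, (t i).Prime)
    (a d₀ d₁ e₀ e₁ : ZMod 2)
    (h01 : addLegendreSym (t 1) (t 0) = a) (h10 : addLegendreSym (t 0) (t 1) = a)
    (hd₀ : addLegendreSym 2 (t 0) = d₀) (hd₁ : addLegendreSym 2 (t 1) = d₁)
    (he₀ : addLegendreSym (-1) (t 0) = e₀) (he₁ : addLegendreSym (-1) (t 1) = e₁) {s : ℕ}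
    (hcard : Fintype.card {v : Fin 2 ⊕ Fin 2 → ZMod 2 // Matrix.fromBlocks
        ((Matrix.of (fun i j : Fin 2 => if i = j then ∑ l ∈ Finset.univ.erase i, ![![1, a], ![a, 1]] i l
          else ![![1, a], ![a, 1]] i j))ᵀ + Matrix.diagonal ![d₀, d₁]) (Matrix.diagonal ![e₀, e₁])
        (Matrix.diagonal ![d₀, d₁])
        (Matrix.of (fun i j : Fin 2 => if i = j then ∑ l ∈ Finset.univ.erase i, ![![1, a], ![a, 1]] i l
          else ![![1, a], ![a, 1]] i j) + Matrix.diagonal ![d₀, d₁]) *ᵥ v = 0} = 2 ^ s) :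
    monskySelmerRankEven t = s :=
  monskySelmerRankEven_eq_of_table t ![![1, a], ![a, 1]] ![d₀, d₁] ![e₀, e₁]
    (fun i j => by
      fin_cases i <;> fin_cases j <;>
        simp [addLegendreSym_self (ht _), h01, h10, Matrix.cons_val_zero, Matrix.cons_val_one])
    (fun i => by fin_cases i <;> simp [hd₀, hd₁, Matrix.cons_val_zero, Matrix.cons_val_one])
    (fun i => by fin_cases i <;> simp [he₀, he₁, Matrix.cons_val_zero, Matrix.cons_val_one])
    hcard

/-- **The row `p ≡ 5 (mod 8)`: `s(2pq) = 1` for primes `p ≡ 5 (mod 8)`, `q ≡ 3 (mod 4)`, BOTH signs of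
`(p/q)`** — pure linear algebra over `𝔽₂` (no named fact; Monsky 1990 Cor 5.15 (2′) prints `#Sel₂ = 8`
on this family, here it is the matrix). Bits: `d = (1, [q ≡ 3 (8)])`, `e = (0, 1)`, `a = [(p/q) = −1]`;
four counted kernels of size `2`.
[cite: HeathBrown1994SelmerCongruentII, Appendix (Monsky), typescript p. 41 L20–L36]
[cite: Monsky1990MockHeegner, Cor. 5.15 (2′) (p. 66)] -/
theorem monskySelmerRankEven_five_pair {p q : ℕ} (hp : p.Prime) (hq : q.Prime) (hp5 : p % 8 = 5)
    (hq4 : q % 4 = 3) : monskySelmerRankEven ![p, q] = 1 := by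
  have hp4 : p % 4 = 1 := by omega
  have hne : p ≠ q := fun h => by omega
  have hqodd : Odd q := Nat.odd_iff.mpr (by omega)
  have ht : ∀ i, (![p, q] i).Prime := fun i => by fin_cases i <;> assumption
  have hd₀ : addLegendreSym 2 (![p, q] 0) = 1 := addLegendreSym_of_eq_neg_one (jacobiSym_two_eq_neg_one (Or.inr hp5))
  have he₀ : addLegendreSym (-1) (![p, q] 0) = 0 := addLegendreSym_of_eq_one (jacobiSym_neg_one_eq_one hp4)
  have he₁ : addLegendreSym (-1) (![p, q] 1) = 1 :=
    addLegendreSym_of_eq_neg_one (DeuringLadic.jacobiSym_neg_one_of_mod_four hq4)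
  rcases jacobiSym_eq_one_or_eq_neg_one_of_prime_ne hp hq hne with hj | hj
  · obtain ⟨h01, h10⟩ := addLegendreSym_pair_of_jacobiSym_eq_one hp4 hqodd hj
    rcases (show q % 8 = 3 ∨ q % 8 = 7 by omega) with h3 | h7
    · exact monskySelmerRankEven_pair_eq_of_bits _ ht 0 1 1 0 1 h01 h10 hd₀
        (addLegendreSym_of_eq_neg_one (jacobiSym_two_eq_neg_one (Or.inl h3))) he₀ he₁ (by decide +kernel)
    · exact monskySelmerRankEven_pair_eq_of_bits _ ht 0 1 0 0 1 h01 h10 hd₀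
        (addLegendreSym_of_eq_one (jacobiSym_two_eq_one (Or.inr h7))) he₀ he₁ (by decide +kernel)
  · obtain ⟨h01, h10⟩ := addLegendreSym_pair_of_jacobiSym_eq_neg_one hp4 hqodd hj
    rcases (show q % 8 = 3 ∨ q % 8 = 7 by omega) with h3 | h7
    · exact monskySelmerRankEven_pair_eq_of_bits _ ht 1 1 1 0 1 h01 h10 hd₀
        (addLegendreSym_of_eq_neg_one (jacobiSym_two_eq_neg_one (Or.inl h3))) he₀ he₁ (by decide +kernel)
    · exact monskySelmerRankEven_pair_eq_of_bits _ ht 1 1 0 0 1 h01 h10 hd₀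
        (addLegendreSym_of_eq_one (jacobiSym_two_eq_one (Or.inr h7))) he₀ he₁ (by decide +kernel)

/-- **The four `s = 3` cells: `s(2pq) = 3` for primes `p ≡ 1 (mod 8)`, `q ≡ 3 (mod 4)` with
`(p/q) = +1`, in EITHER tuple order** (`A = 0`, `d = e = 0` at `p`; kernels of size `8`). On these
cells the hypothesis `s = 1` of the even law is vacuous. Pure linear algebra, no named fact.
[cite: HeathBrown1994SelmerCongruentII, Appendix (Monsky), typescript p. 41 L20–L36] -/
theorem monskySelmerRankEven_one_pair_of_jacobiSym_eq_one {p q : ℕ} (hp : p.Prime) (hq : q.Prime)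
    (hp1 : p % 8 = 1) (hq4 : q % 4 = 3) (hj : jacobiSym p q = 1) :
    monskySelmerRankEven ![p, q] = 3 ∧ monskySelmerRankEven ![q, p] = 3 := by
  have hp4 : p % 4 = 1 := by omega
  have hne : p ≠ q := fun h => by omega
  have hqodd : Odd q := Nat.odd_iff.mpr (by omega)
  have ht : ∀ i, (![p, q] i).Prime := fun i => by fin_cases i <;> assumption
  have ht' : ∀ i, (![q, p] i).Prime := fun i => by fin_cases i <;> assumption
  obtain ⟨hqp, hpq⟩ := addLegendreSym_pair_of_jacobiSym_eq_one hp4 hqodd hj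
  have hdp : addLegendreSym 2 p = 0 := addLegendreSym_of_eq_one (jacobiSym_two_eq_one (Or.inl hp1))
  have hep : addLegendreSym (-1) p = 0 := addLegendreSym_of_eq_one (jacobiSym_neg_one_eq_one hp4)
  have heq : addLegendreSym (-1) q = 1 :=
    addLegendreSym_of_eq_neg_one (DeuringLadic.jacobiSym_neg_one_of_mod_four hq4)
  rcases (show q % 8 = 3 ∨ q % 8 = 7 by omega) with h3 | h7
  · have hdq : addLegendreSym 2 q = 1 := addLegendreSym_of_eq_neg_one (jacobiSym_two_eq_neg_one (Or.inl h3))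
    exact ⟨monskySelmerRankEven_pair_eq_of_bits _ ht 0 0 1 0 1 hqp hpq hdp hdq hep heq (by decide +kernel),
      monskySelmerRankEven_pair_eq_of_bits _ ht' 0 1 0 1 0 hpq hqp hdq hdp heq hep (by decide +kernel)⟩
  · have hdq : addLegendreSym 2 q = 0 := addLegendreSym_of_eq_one (jacobiSym_two_eq_one (Or.inr h7))
    exact ⟨monskySelmerRankEven_pair_eq_of_bits _ ht 0 0 0 0 1 hqp hpq hdp hdq hep heq (by decide +kernel),
      monskySelmerRankEven_pair_eq_of_bits _ ht' 0 0 0 1 0 hpq hqp hdq hdp heq hep (by decide +kernel)⟩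

/-- **The Legendre graph of a class-`6` pair is odd**: for primes `q ≡ 3 (mod 4)`, `p ≡ 1 (mod 8)` with
`(p/q) = −1`, the kernel of Monsky's `A` on the tuple `(q, p)` is `{0, 𝟙}` — the hypothesis `hG` of
`Tian2014.odd_genusSum₂'_two_mul_caseSix` / DOOR C6 at tuple length `2`.
[cite: Tian2014, Thm. 1.3 and Lemma 5.3 (arXiv p. 2 L5–L15; p. 28)] -/
theorem legendreGraph_odd_pair {p q : ℕ} (hp : p.Prime) (hq : q.Prime) (hp1 : p % 8 = 1)
    (hq4 : q % 4 = 3) (hj : jacobiSym p q = -1) :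
    ∀ v, legendreMatrix ![q, p] *ᵥ v = 0 → v = 0 ∨ v = fun _ => 1 := by
  have hp4 : p % 4 = 1 := by omega
  have hqodd : Odd q := Nat.odd_iff.mpr (by omega)
  obtain ⟨hqp, hpq⟩ := addLegendreSym_pair_of_jacobiSym_eq_neg_one hp4 hqodd hj
  rw [legendreMatrix_eq_ofTable ![q, p] ![![1, 1], ![1, 1]] (fun i j => by
    fin_cases i <;> fin_cases j <;>
      simp [addLegendreSym_self hp, addLegendreSym_self hq, hqp, hpq, Matrix.cons_val_zero,
        Matrix.cons_val_one])]
  decide +kernel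

/-- From `2t₀t₁ ≡ 6 (mod 8)` for primes `t₀ ≠ t₁`: an ordered pair `(p, q)` of the two primes with
`p ≡ 1 (mod 4)`, `q ≡ 3 (mod 4)` (selection-side residue bookkeeping).
[cite: HeathBrown1994SelmerCongruentII, §1 (typescript p. 1)] -/
theorem exists_pair_of_two_mul_prod_mod_eight_six (t : Fin 2 → ℕ) (ht : ∀ i, (t i).Prime)
    (hinj : Function.Injective t) (h6 : (2 * ∏ i, t i) % 8 = 6) :
    ∃ p q : ℕ, p.Prime ∧ q.Prime ∧ p ≠ q ∧ p % 4 = 1 ∧ q % 4 = 3 ∧ t 0 * t 1 = p * q ∧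
      (t = ![p, q] ∨ t = ![q, p]) := by
  have hodd : ∀ i, Odd (t i) := odd_of_two_mul_prod_mod_eight_six t rfl h6
  rw [Fin.prod_univ_two] at h6
  have hne : t 0 ≠ t 1 := fun h => absurd (hinj h) (by decide)
  have h0 := Nat.odd_iff.mp (hodd 0)
  have h1 := Nat.odd_iff.mp (hodd 1)
  have hm : (t 0 % 4) * (t 1 % 4) % 4 = 3 := by rw [← Nat.mul_mod]; omega
  have ht01 : t = ![t 0, t 1] := by ext i; fin_cases i <;> rfl
  rcases (show t 0 % 4 = 1 ∨ t 0 % 4 = 3 by omega) with h01 | h03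
  · rw [h01] at hm
    exact ⟨t 0, t 1, ht 0, ht 1, hne, h01, by omega, rfl, Or.inl ht01⟩
  · rw [h03] at hm
    refine ⟨t 1, t 0, ht 1, ht 0, hne.symm, by omega, h03, mul_comm _ _, Or.inr ?_⟩
    exact ht01

end Table

/-! ## §3 `Σ₂′(2pq)` on the `s = 1` locus, modulo Rédei–Reichardt: the SILENT cells are exactly `𝒮⁻` -/

section GenusSum

/-- **`g(pq)` is ODD for primes `p ≡ 5 (mod 8)`, `q ≡ 3 (mod 8)` with `(p/q) = −1`** (mod RR): `pq ≡ 7 (mod 8)`,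
`disc = −pq`; both off-diagonal Rédei bits are `[(p/q) = −1] = 1`, so the Rédei matrix is `(1 1; 1 1)` with
kernel `{0, 𝟙}` (`r₄ = 0`). The other half of `P2.not_odd_genusClassNumber_genusField_five_mul_three`.
[cite: LiMa2008, Thm. 0.4 with Lemma 0.1] [cite: TianYuanZhang2017, §1 (g(d))] -/
theorem odd_genusClassNumber_genusField_five_mul_three_of_jacobiSym_eq_neg_one
    (hR : redeiReichardt_fourTwoCard_classGroup) {p q : ℕ} (hp : p.Prime) (hq : q.Prime)
    (hp5 : p % 8 = 5) (hq3 : q % 8 = 3) (hj : jacobiSym p q = -1) :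
    Odd (genusClassNumber (GenusField (p * q))) := by
  have hq2 : q ≠ 2 := by omega
  have hp4 : p % 4 = 1 := by omega
  have hne : p ≠ q := fun h => by omega
  have hprod : ∏ i, (![p, q] : Fin 2 → ℕ) i = if (p * q) % 4 = 1 then 2 * (p * q) else p * q := by
    rw [if_neg (by rw [Nat.mul_mod, hp4, show q % 4 = 3 by omega]; decide)]; simp [Fin.prod_univ_two]
  have hinj : Function.Injective (![p, q] : Fin 2 → ℕ) := by
    intro i j h
    fin_cases i <;> fin_cases j <;> simp_all [hne.symm]
  rw [odd_genusClassNumber_genusField_iff_card_ker hR (ι := Fin 2) ![p, q]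
    (fun i => by fin_cases i <;> assumption) hinj hprod]
  obtain ⟨h1, h2⟩ := kroneckerBit_primeDisc_eq_of_mod_four_one (d := p * q) hp hq hp4 hq2 hne
  have h0 : kroneckerBit p q = 1 := (kroneckerBit_of_jacobiSym hp hq hq2 hne).2 hj
  have hb1 : kroneckerBit (primeDisc (p * q) q) p = 1 := by rw [h1, h0]
  have hb2 : kroneckerBit (primeDisc (p * q) p) q = 1 := by rw [h2, h0]
  have e : (Matrix.of fun a b : Fin 2 =>
      if a = b then ∑ c ∈ univ.erase a, kroneckerBit (primeDisc (p * q) ((![p, q] : Fin 2 → ℕ) c))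
        ((![p, q] : Fin 2 → ℕ) a)
      else kroneckerBit (primeDisc (p * q) ((![p, q] : Fin 2 → ℕ) b)) ((![p, q] : Fin 2 → ℕ) a)) =
      !![1, 1; 1, 1] := by
    ext a b
    fin_cases a <;> fin_cases b <;> simp [hb1, hb2]
  rw [e]
  decide

/-- **`Σ₂′(2pq)` over `GenusField` is EVEN on `𝒮⁻`**: primes `p ≡ 5 (mod 8)`, `q ≡ 3 (mod 4)`, `(p/q) = −1`
(mod RR). By `natCast_genusSum₂'_three` on `(2, p, q)`: `q ≡ 3 (mod 8)`: `Σ₂′ ≡ g(2pq) + g(2)g(pq) ≡ 1 + 1`;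
`q ≡ 7 (mod 8)`: `Σ₂′ ≡ g(2pq) + g(q)g(2p) ≡ 1 + 1`. U⁺ is silent on `𝒮⁻`; this is the cell condition of
C-P2-1 as a theorem. (p2-monsky-x: parity `= [(p/q) = +1]` on 72 221 pairs `< 3·10⁶`, EVIDENCE.)
[cite: TianYuanZhang2017, Thm. 1.2 (the second sum, p0002 L121–L129); proof of Prop. 3.4 (p0016 L146)]
[cite: LiMa2008, Thm. 0.4] -/
theorem even_genusSum₂'_genusField_two_mul_five_mul (hR : redeiReichardt_fourTwoCard_classGroup)
    {p q : ℕ} (hp : p.Prime) (hq : q.Prime) (hp5 : p % 8 = 5) (hq4 : q % 4 = 3)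
    (hj : jacobiSym p q = -1) :
    Even (genusSum₂' (2 * (p * q)) fun d => genusClassNumber (GenusField d)) := by
  have hp2 : p ≠ 2 := by omega
  have hq2 : q ≠ 2 := by omega
  have hne : p ≠ q := fun h => by omega
  have h0 : kroneckerBit p q = 1 := (kroneckerBit_of_jacobiSym hp hq hq2 hne).2 hj
  have h8' : (2 * p * q) % 8 = 5 ∨ (2 * p * q) % 8 = 6 ∨ (2 * p * q) % 8 = 7 := by
    have hpq4 : (p * q) % 4 = 3 := by rw [Nat.mul_mod, show p % 4 = 1 by omega, hq4]
    rw [mul_assoc]; omega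
  rw [← ZMod.natCast_eq_zero_iff_even, show 2 * (p * q) = 2 * p * q by ring,
    natCast_genusSum₂'_three _ Nat.prime_two hp hq hp2.symm hq2.symm hne h8']
  have hb2 : pat₂ p (2 * q) = false := by
    rw [← pat₂_mod, hp5, show (2 * q) % 8 = 6 by omega]; decide
  have hb3 : pat₃ 2 p q = false := by
    rw [← pat₃_mod, hp5]
    rcases (show q % 8 = 3 ∨ q % 8 = 7 by omega) with h | h <;> rw [h] <;> decide
  have g2 : ((genusClassNumber (GenusField 2) : ℕ) : ZMod 2) = 1 :=
    (ZMod.natCast_eq_one_iff_odd).mpr (odd_genusClassNumber_two hR (GenusField 2)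
      (isQuadraticFieldOfSqrt_genusField (d := 2) (by norm_num)))
  have g2p : ((genusClassNumber (GenusField (2 * p)) : ℕ) : ZMod 2) = 1 :=
    (ZMod.natCast_eq_one_iff_odd).mpr (odd_genusClassNumber_genusField_two_mul_prime_five hR hp hp5)
  have gq : ((genusClassNumber (GenusField q) : ℕ) : ZMod 2) = 1 :=
    (ZMod.natCast_eq_one_iff_odd).mpr (odd_genusClassNumber_genusField_prime hR hq hq4)
  have g2pq : ((genusClassNumber (GenusField (2 * p * q)) : ℕ) : ZMod 2) = 1 := by
    rw [show 2 * p * q = 2 * (p * q) by ring]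
    exact (ZMod.natCast_eq_one_iff_odd).mpr
      ((odd_genusClassNumber_genusField_two_mul_five_mul_iff hR hp hq hp5 hq4).mpr (Or.inr h0))
  rcases (show q % 8 = 3 ∨ q % 8 = 7 by omega) with h3 | h7
  · have hb1 : pat₂ 2 (p * q) = true := by
      rw [← pat₂_mod, show (p * q) % 8 = 7 by rw [Nat.mul_mod, hp5, h3]]; decide
    have hbq : pat₂ q (2 * p) = false := by
      rw [← pat₂_mod, h3, show (2 * p) % 8 = 2 by omega]; decide
    have gpq : ((genusClassNumber (GenusField (p * q)) : ℕ) : ZMod 2) = 1 :=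
      (ZMod.natCast_eq_one_iff_odd).mpr
        (odd_genusClassNumber_genusField_five_mul_three_of_jacobiSym_eq_neg_one hR hp hq hp5 h3 hj)
    simp [hb1, hb2, hbq, hb3, g2pq, gpq, g2, bitOf]
    decide
  · have hb1 : pat₂ 2 (p * q) = false := by
      rw [← pat₂_mod, show (p * q) % 8 = 3 by rw [Nat.mul_mod, hp5, h7]]; decide
    have hbq : pat₂ q (2 * p) = true := by
      rw [← pat₂_mod, h7, show (2 * p) % 8 = 2 by omega]; decide
    simp [hb1, hb2, hbq, hb3, g2pq, gq, g2p, bitOf]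
    decide

/-- **`Σ₂′(2pq)` is ODD on a class-`6` pair**: primes `p ≡ 1 (mod 8)`, `q ≡ 3 (mod 4)`, `(p/q) = −1` (mod RR)
— `Tian2014.odd_genusSum₂'_two_mul_caseSix` on the tuple `(q, p)` (odd graph by `legendreGraph_odd_pair`).
[cite: TianYuanZhang2017, Thm. 1.2 (p0002 L121–L129)] [cite: Tian2014, Thm. 1.3] [cite: LiMa2008, Thm. 0.4] -/
theorem odd_genusSum₂'_genusField_two_mul_one_pair (hR : redeiReichardt_fourTwoCard_classGroup)
    {p q : ℕ} (hp : p.Prime) (hq : q.Prime) (hp1 : p % 8 = 1) (hq4 : q % 4 = 3)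
    (hj : jacobiSym p q = -1) :
    Odd (genusSum₂' (2 * (p * q)) fun d => genusClassNumber (GenusField d)) := by
  have hne : p ≠ q := fun h => by omega
  have ht : ∀ i, ((![q, p] : Fin (1 + 1) → ℕ) i).Prime := fun i => by fin_cases i <;> assumption
  have hinj : Function.Injective (![q, p] : Fin (1 + 1) → ℕ) := by
    intro i j h
    fin_cases i <;> fin_cases j <;> simp_all [hne.symm]
  have h := odd_genusSum₂'_two_mul_caseSix (![q, p] : Fin (1 + 1) → ℕ) hR ht hinj hq4
    (fun i hi => by fin_cases i <;> simp_all) (legendreGraph_odd_pair hp hq hp1 hq4 hj)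
    (show ∏ i, (![q, p] : Fin (1 + 1) → ℕ) i = p * q by simp [Fin.prod_univ_two, mul_comm])
  exact h

end GenusSum

end Summit.BirchSwinnertonDyer.Rank1Residual.P2

end
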